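import Summits.HubbardSuperconductivity.HubbardSuperconductivity.Theses.ColourTheSpin

/-!
# Crux `SgAnchorOrder` (stmt-HubbardSuperconductivity-16273, route `ColourTheSpin`) —
# line `freeze-flux-negation`: a NEGATION line (concludes `¬ SgAnchorOrder` by name)

Crux-strategist line (planner-cstrat-stmt-HubbardSuperconductivity-16273-b1-0, 2026-08-17).
STRATEGY-CENSUS.md (same crux directory) records why no positive line / decomposition of
`SgAnchorOrder` is admissible: the crux is refutable as typed by STRONG-COUPLING FREEZING +
FLUX ORTHOGONALITY (refuter-rreview-0816T18-1-0, evidence v1–v3 + `CTS_SchurFacts.lean` + toy ED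
kit j019493; registrar planner-skel-…-16273-0, `NegationSkeleton.lean` in this directory; re-derived
independently by this seat). This file REFINES the registrar's two-stub negation skeleton
(`PairCeiling`, `GroundStateExists`) by splitting the M–L stub `PairCeiling` into the two lemmas that
actually carry it, with a kernel-checked composition, so that each piece can be landed separately
(`--supports stmt-HubbardSuperconductivity-16273`) and the refutation
`Theorems/ColourTheSpinSgAnchorOrderRefutation.lean` assembled from them:

* `FluxCeiling` — PURE OPERATOR INEQUALITY (no ground state, no `g`-dependence of the constants,
  every `U, δ, g`, every `L ≥ 1`, EVERY vector `ψ` of the `N_L`-block):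
  `⟨ψ,(P†P)_B ψ⟩ ≤ 64·L²·‖ψ‖² + 128·L⁴·⟨ψ,(1 ⊗ Σ_b E_b)_B ψ⟩`.
  Proof sketch: `‖Pφ‖² ≤ 2‖PΠ₀φ‖² + 2‖P(1−Π₀)φ‖²` (`φ` = `ψ` extended by zero, `Π₀` = fermions ⊗
  constant link function); flux orthogonality `⟨P_bΠ₀φ, P_b'Π₀φ⟩ = 0` for `b ≠ b'` because the pair
  link factor `M_στ(u) = (ερ(u))_στ` has `Σ_(u∈Q8) M_στ(u) = 0` (refuter's `sum_rQ`), and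
  `‖P_b‖ ≤ 4`, so `‖PΠ₀φ‖² ≤ 16·|Bond L|·‖φ‖² = 32L²‖φ‖²`; `‖P‖ ≤ 4|Bond L| = 8L²` and
  `1 − Π₀ ≤ Σ_b (1 − Q_b) = Σ_b E_b` (commuting projections `Q_b` = average over link `b`), so
  `‖P(1−Π₀)φ‖² ≤ 64L⁴⟨φ, ΣE_b φ⟩`.
* `ElectricConcentration` — the ONLY place the ground-state property is used (variational):
  for `U > 0`, `δ ∈ (0,½)`, `g ≥ 1`, `L ≥ 1` and every ground state `ψ` of the block,
  `g²·⟨ψ,(1 ⊗ Σ_b E_b)_B ψ⟩ ≤ (18 + U)·L²·‖ψ‖²`.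
  Proof sketch: `E‖ψ‖² = ⟨ψ,H_Bψ⟩ ≥ −‖hop+hop†‖‖ψ‖² + g²⟨ΣE_b⟩` (`U`-term and magnetic term PSD,
  `‖hop + hop†‖ ≤ 2·4·|Bond L| = 16L²`), and `E ≤` Rayleigh quotient of the trial vector
  `Σ_k e_(s₀,k)` (`s₀` any `N_L`-subset of the `2L²` orbitals, constant in the links): hopping `0`,
  `U`-term `≤ U·L²`, electric `0` (constants are flux-free), magnetic `≤ 2L²/g² ≤ 2L²`.
* `GroundStateExists` — verbatim the registrar's stub (Hermitian block on a non-empty index type has a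
  normalised bottom eigenvector, which minimises the Rayleigh quotient). S–M.

Composition (sorry-free): `pairCeiling_of : FluxCeiling → ElectricConcentration → PairCeiling` with
witnesses `A = 65`, `G(L,U) = 128·(18+U)·L²` (pure real arithmetic `arith_ceiling` after defeq
instantiation through the crux's verbatim `let` block), then the registrar's
`not_SgAnchorOrder_of_stubs : PairCeiling → GroundStateExists → ¬ SgAnchorOrder` (copied verbatim,
credit planner-skel-stmt-HubbardSuperconductivity-16273-0) and `not_SgAnchorOrder_of : ¬ SgAnchorOrder`.
`sorry` ONLY in the three `stub_*`.

The `let` blocks are the crux's, VERBATIM (binder names `U δ g L`), plus one extra binder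
`Eel := 1 ⊗ Σ_b E_b` (the crux's own inlined electric matrix) in the two new stubs.
-/

noncomputable section

set_option linter.dupNamespace false
set_option linter.unusedVariables false

namespace Summit.HubbardSuperconductivity.HubbardSuperconductivity.Cruxes.SgAnchorOrder.FreezeFluxNegation

open scoped BigOperators Topology Manifold Classical MeasureTheory ProbabilityTheory Matrix InnerProductSpace ComplexConjugate ContinuousMap
open Filter Set Function TopologicalSpace MeasureTheory
open Literature.Hubbard
open Summit.HubbardSuperconductivity.HubbardSuperconductivity.Theses.ColourTheSpin

/-! ## Stub statements -/

/-- STUB 1 — FLUX CEILING (pure operator inequality on the `N_L`-block; all `U δ g`, `L ≥ 1`, all `ψ`):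
`⟨ψ,(P†P)_B ψ⟩.re ≤ 64·L²·(ψ†ψ).re + 128·L⁴·⟨ψ,(1⊗Σ_b E_b)_B ψ⟩.re`. Flux orthogonality of the transported
bond pair field on the electric vacuum (`Σ_u (ερ(u))_στ = 0`) + `‖P‖ ≤ 8L²` + `1 − Π₀ ≤ Σ_b E_b`.
[refuter-rreview-0816T18-1-0 CTS_SchurFacts.lean `sum_rQ`; doi:10.1103/physrevd.12.3978; doi:10.1103/physrevd.11.395] -/
def FluxCeiling : Prop :=
  open Literature.MathematicalPhysics.QuantumLattice in ∀ (U δ g : ℝ) (L : ℕ) [NeZero L], (let m : Fin 2 × ZMod 4 → Fin 2 × ZMod 4 → Fin 2 × ZMod 4 := fun u v => (u.1 + v.1, if u.1 = 0 then (if v.1 = 0 then u.2 + v.2 else v.2 - u.2) else if v.1 = 0 then u.2 + v.2 else 2 + v.2 - u.2); let iv : Fin 2 × ZMod 4 → Fin 2 × ZMod 4 := fun u => (u.1, if u.1 = 0 then -u.2 else u.2 + 2); let r : Fin 2 × ZMod 4 → Fin 2 → Fin 2 → ℂ := fun u σ τ => if u.1 = 0 then (if σ = τ then (if σ = 0 then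 Complex.I else -Complex.I) ^ u.2.val else 0) else if σ = τ then 0 else if σ = 0 then -(-Complex.I) ^ u.2.val else Complex.I ^ u.2.val; let hop := ∑ b : GaugedHubbard.Bond L, ∑ σ : Fin 2, ∑ τ : Fin 2, Matrix.kroneckerMap (· * ·) (creation (orb b.1 σ) * annihilation (orb (b.1.shift b.2) τ)) (Matrix.diagonal fun k : GaugedHubbard.Bond L → Fin 2 × ZMod 4 => r (k b) σ τ); let H := -(hop + hopᴴ) + ((U : ℝ) : ℂ) • Matrix.kroneckerMap (· * ·) (∑ x : FermionTorus 2 L, numberOp x 0 * numberOp x 1) (1 : Matrix (GaugedHubbard.Bond L → Fin 2 × ZMod 4) (GaugedHubbard.Bond L → Fin 2 × ZMod 4) ℂ) + ((g ^ 2 : ℝ) : ℂ) • Matrix.kroneckerMap (· * ·) (1 : Matrix (Finset (Orb (FermionTorus 2 L))) _ ℂ) (∑ b : GaugedHubbard.Bond L, Matrix.of fun k k' : GaugedHubbard.Bond L → Fin 2 × ZMod 4 => if k' = Function.update k b (k' b) then (if k b = k' b then (1 : ℂ) else 0) - 1 / 8 else 0) + ((1 / g ^ 2 : ℝ) : ℂ)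 • Matrix.kroneckerMap (· * ·) (1 : Matrix (Finset (Orb (FermionTorus 2 L))) _ ℂ) (Matrix.diagonal fun k : GaugedHubbard.Bond L → Fin 2 × ZMod 4 => ∑ x : FermionTorus 2 L, (1 - (r (m (m (m (k (x, 0)) (k (x.shift 0, 1))) (iv (k (x.shift 1, 0)))) (iv (k (x, 1)))) 0 0 + r (m (m (m (k (x, 0)) (k (x.shift 0, 1))) (iv (k (x.shift 1, 0)))) (iv (k (x, 1)))) 1 1) / 2)); let P := ∑ b : GaugedHubbard.Bond L, (if b.2 = 0 then (1 : ℂ) else -1) • ∑ σ : Fin 2, ∑ τ : Fin 2, Matrix.kroneckerMap (· * ·) (annihilation (orb b.1 σ) * annihilation (orb (b.1.shift b.2) τ)) (Matrix.diagonal fun k : GaugedHubbard.Bond L → Fin 2 × ZMod 4 => if σ = 0 then r (k b) 1 τ else -r (k b) 0 τ); let p := fun ik : Finset (Orb (FermionTorus 2 L)) × (GaugedHubbard.Bond L → Fin 2 × ZMod 4) => ik.1.card = 2 * ⌊(1 - δ) * (L : ℝ) ^ 2 / 2⌋₊; let Eel := Matrix.kroneckerMap (· * ·) (1 : Matrix (Finset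 (Orb (FermionTorus 2 L))) _ ℂ) (∑ b : GaugedHubbard.Bond L, Matrix.of fun k k' : GaugedHubbard.Bond L → Fin 2 × ZMod 4 => if k' = Function.update k b (k' b) then (if k b = k' b then (1 : ℂ) else 0) - 1 / 8 else 0); ∀ ψ : {ik // p ik} → ℂ, (star ψ ⬝ᵥ (Pᴴ * P).toBlock p p *ᵥ ψ).re ≤ 64 * (L : ℝ) ^ 2 * (star ψ ⬝ᵥ ψ).re + 128 * (L : ℝ) ^ 4 * (star ψ ⬝ᵥ Eel.toBlock p p *ᵥ ψ).re)

/-- STUB 2 — ELECTRIC CONCENTRATION OF BLOCK GROUND STATES (variational; `U > 0`, `δ ∈ (0,½)`,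
`g ≥ 1`, `L ≥ 1`): `g²·⟨ψ,(1⊗Σ_b E_b)_B ψ⟩.re ≤ (18 + U)·L²·(ψ†ψ).re` for every ground state `ψ` of the
`N_L`-block (`‖hop + hop†‖ ≤ 16L²`, trial vector = an `N_L`-configuration ⊗ constant links:
energy `≤ U·L² + 2L²/g²`). [doi:10.1103/physrevd.11.395; folklore (strong-coupling expansion, leading order)] -/
def ElectricConcentration : Prop :=
  open Literature.MathematicalPhysics.QuantumLattice in ∀ U : ℝ, 0 < U → ∀ δ ∈ Set.Ioo (0 : ℝ) (1 / 2), ∀ g : ℝ, 1 ≤ g → ∀ (L : ℕ) [NeZero L], (let m : Fin 2 × ZMod 4 → Fin 2 × ZMod 4 → Fin 2 × ZMod 4 := fun u v => (u.1 + v.1, if u.1 = 0 then (if v.1 = 0 then u.2 + v.2 else v.2 - u.2) else if v.1 = 0 then u.2 + v.2 else 2 + v.2 - u.2); let iv : Fin 2 × ZMod 4 → Fin 2 × ZMod 4 := fun u => (u.1, if u.1 = 0 then -u.2 else u.2 + 2); let r : Fin 2 × ZMod 4 → Fin 2 → Fin 2 → ℂ := fun u σ τ => if u.1 = 0 then (if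 σ = τ then (if σ = 0 then Complex.I else -Complex.I) ^ u.2.val else 0) else if σ = τ then 0 else if σ = 0 then -(-Complex.I) ^ u.2.val else Complex.I ^ u.2.val; let hop := ∑ b : GaugedHubbard.Bond L, ∑ σ : Fin 2, ∑ τ : Fin 2, Matrix.kroneckerMap (· * ·) (creation (orb b.1 σ) * annihilation (orb (b.1.shift b.2) τ)) (Matrix.diagonal fun k : GaugedHubbard.Bond L → Fin 2 × ZMod 4 => r (k b) σ τ); let H := -(hop + hopᴴ) + ((U : ℝ) : ℂ) • Matrix.kroneckerMap (· * ·) (∑ x : FermionTorus 2 L, numberOp x 0 * numberOp x 1) (1 : Matrix (GaugedHubbard.Bond L → Fin 2 × ZMod 4) (GaugedHubbard.Bond L → Fin 2 × ZMod 4) ℂ) + ((g ^ 2 : ℝ) : ℂ) • Matrix.kroneckerMap (· * ·) (1 : Matrix (Finset (Orb (FermionTorus 2 L))) _ ℂ) (∑ b : GaugedHubbard.Bond L, Matrix.of fun k k' : GaugedHubbard.Bond L → Fin 2 × ZMod 4 => if k' = Function.update k b (k' b) then (if k b = k' b then (1 : ℂ) else 0) - 1 / 8 else 0) + ((1 / g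 ^ 2 : ℝ) : ℂ) • Matrix.kroneckerMap (· * ·) (1 : Matrix (Finset (Orb (FermionTorus 2 L))) _ ℂ) (Matrix.diagonal fun k : GaugedHubbard.Bond L → Fin 2 × ZMod 4 => ∑ x : FermionTorus 2 L, (1 - (r (m (m (m (k (x, 0)) (k (x.shift 0, 1))) (iv (k (x.shift 1, 0)))) (iv (k (x, 1)))) 0 0 + r (m (m (m (k (x, 0)) (k (x.shift 0, 1))) (iv (k (x.shift 1, 0)))) (iv (k (x, 1)))) 1 1) / 2)); let P := ∑ b : GaugedHubbard.Bond L, (if b.2 = 0 then (1 : ℂ) else -1) • ∑ σ : Fin 2, ∑ τ : Fin 2, Matrix.kroneckerMap (· * ·) (annihilation (orb b.1 σ) * annihilation (orb (b.1.shift b.2) τ)) (Matrix.diagonal fun k : GaugedHubbard.Bond L → Fin 2 × ZMod 4 => if σ = 0 then r (k b) 1 τ else -r (k b) 0 τ); let p := fun ik : Finset (Orb (FermionTorus 2 L)) × (GaugedHubbard.Bond L → Fin 2 × ZMod 4) => ik.1.card = 2 * ⌊(1 - δ) * (L : ℝ) ^ 2 / 2⌋₊; let Eel := Matrix.kroneckerMap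 (· * ·) (1 : Matrix (Finset (Orb (FermionTorus 2 L))) _ ℂ) (∑ b : GaugedHubbard.Bond L, Matrix.of fun k k' : GaugedHubbard.Bond L → Fin 2 × ZMod 4 => if k' = Function.update k b (k' b) then (if k b = k' b then (1 : ℂ) else 0) - 1 / 8 else 0); ∀ ψ : {ik // p ik} → ℂ, (ψ ≠ 0 ∧ ∃ E : ℝ, H.toBlock p p *ᵥ ψ = (E : ℂ) • ψ ∧ ∀ φ : {ik // p ik} → ℂ, E * (star φ ⬝ᵥ φ).re ≤ (star φ ⬝ᵥ H.toBlock p p *ᵥ φ).re) → g ^ 2 * (star ψ ⬝ᵥ Eel.toBlock p p *ᵥ ψ).re ≤ (18 + U) * (L : ℝ) ^ 2 * (star ψ ⬝ᵥ ψ).re)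

/-- THE REGISTRAR'S CEILING (verbatim `NegationSkeleton.lean`, planner-skel-…-16273-0): derived below
from STUB 1 + STUB 2 with `A = 65`, `G = 128·(18+U)·L²`; kept as the interface to the registrar's
sorry-free composition `not_SgAnchorOrder_of_stubs`. -/
def PairCeiling : Prop :=
  open Literature.MathematicalPhysics.QuantumLattice in ∃ A : ℝ, ∀ U : ℝ, 0 < U → ∀ δ ∈ Set.Ioo (0 : ℝ) (1 / 2), ∀ (L : ℕ) [NeZero L], ∃ G : ℝ, ∀ g : ℝ, G ≤ g → (let m : Fin 2 × ZMod 4 → Fin 2 × ZMod 4 → Fin 2 × ZMod 4 := fun u v => (u.1 + v.1, if u.1 = 0 then (if v.1 = 0 then u.2 + v.2 else v.2 - u.2) else if v.1 = 0 then u.2 + v.2 else 2 + v.2 - u.2); let iv : Fin 2 × ZMod 4 → Fin 2 × ZMod 4 := fun u => (u.1, if u.1 = 0 then -u.2 else u.2 + 2); let r : Fin 2 × ZMod 4 → Fin 2 → Fin 2 → ℂ := fun u σ τ => if u.1 = 0 then (if σ = τ then (if σ = 0 then Complex.I else -Complex.I) ^ u.2.val else 0) else if σ = τ then 0 else if σ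 = 0 then -(-Complex.I) ^ u.2.val else Complex.I ^ u.2.val; let hop := ∑ b : GaugedHubbard.Bond L, ∑ σ : Fin 2, ∑ τ : Fin 2, Matrix.kroneckerMap (· * ·) (creation (orb b.1 σ) * annihilation (orb (b.1.shift b.2) τ)) (Matrix.diagonal fun k : GaugedHubbard.Bond L → Fin 2 × ZMod 4 => r (k b) σ τ); let H := -(hop + hopᴴ) + ((U : ℝ) : ℂ) • Matrix.kroneckerMap (· * ·) (∑ x : FermionTorus 2 L, numberOp x 0 * numberOp x 1) (1 : Matrix (GaugedHubbard.Bond L → Fin 2 × ZMod 4) (GaugedHubbard.Bond L → Fin 2 × ZMod 4) ℂ) + ((g ^ 2 : ℝ) : ℂ) • Matrix.kroneckerMap (· * ·) (1 : Matrix (Finset (Orb (FermionTorus 2 L))) _ ℂ) (∑ b : GaugedHubbard.Bond L, Matrix.of fun k k' : GaugedHubbard.Bond L → Fin 2 × ZMod 4 => if k' = Function.update k b (k' b) then (if k b = k' b then (1 : ℂ) else 0) - 1 / 8 else 0) + ((1 / g ^ 2 : ℝ) : ℂ) • Matrix.kroneckerMap (· * ·) (1 : Matrix (Finset (Orb (FermionTorus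 2 L))) _ ℂ) (Matrix.diagonal fun k : GaugedHubbard.Bond L → Fin 2 × ZMod 4 => ∑ x : FermionTorus 2 L, (1 - (r (m (m (m (k (x, 0)) (k (x.shift 0, 1))) (iv (k (x.shift 1, 0)))) (iv (k (x, 1)))) 0 0 + r (m (m (m (k (x, 0)) (k (x.shift 0, 1))) (iv (k (x.shift 1, 0)))) (iv (k (x, 1)))) 1 1) / 2)); let P := ∑ b : GaugedHubbard.Bond L, (if b.2 = 0 then (1 : ℂ) else -1) • ∑ σ : Fin 2, ∑ τ : Fin 2, Matrix.kroneckerMap (· * ·) (annihilation (orb b.1 σ) * annihilation (orb (b.1.shift b.2) τ)) (Matrix.diagonal fun k : GaugedHubbard.Bond L → Fin 2 × ZMod 4 => if σ = 0 then r (k b) 1 τ else -r (k b) 0 τ); let p := fun ik : Finset (Orb (FermionTorus 2 L)) × (GaugedHubbard.Bond L → Fin 2 × ZMod 4) => ik.1.card = 2 * ⌊(1 - δ) * (L : ℝ) ^ 2 / 2⌋₊; ∀ ψ : {ik // p ik} → ℂ, (ψ ≠ 0 ∧ ∃ E : ℝ, H.toBlock p p *ᵥ ψ = (E : ℂ) •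 ψ ∧ ∀ φ : {ik // p ik} → ℂ, E * (star φ ⬝ᵥ φ).re ≤ (star φ ⬝ᵥ H.toBlock p p *ᵥ φ).re) → (star ψ ⬝ᵥ (Pᴴ * P).toBlock p p *ᵥ ψ).re ≤ A * (L : ℝ) ^ 2 * (star ψ ⬝ᵥ ψ).re)

/-- STUB 3 — verbatim the registrar's `GroundStateExists` (normalised bottom eigenvector of the Hermitian
block on a non-empty index type; `Matrix.IsHermitian.eigenvectorBasis`). -/
def GroundStateExists : Prop :=
  open Literature.MathematicalPhysics.QuantumLattice in ∀ (U δ g : ℝ) (L : ℕ) [NeZero L], δ ∈ Set.Ioo (0 : ℝ) (1 / 2) → (let m : Fin 2 × ZMod 4 → Fin 2 × ZMod 4 → Fin 2 × ZMod 4 := fun u v => (u.1 + v.1, if u.1 = 0 then (if v.1 = 0 then u.2 + v.2 else v.2 - u.2) else if v.1 = 0 then u.2 + v.2 else 2 + v.2 - u.2); let iv : Fin 2 × ZMod 4 → Fin 2 × ZMod 4 := fun u => (u.1, if u.1 = 0 then -u.2 else u.2 + 2); let r : Fin 2 × ZMod 4 → Fin 2 → Fin 2 → ℂ := fun u σ τ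 => if u.1 = 0 then (if σ = τ then (if σ = 0 then Complex.I else -Complex.I) ^ u.2.val else 0) else if σ = τ then 0 else if σ = 0 then -(-Complex.I) ^ u.2.val else Complex.I ^ u.2.val; let hop := ∑ b : GaugedHubbard.Bond L, ∑ σ : Fin 2, ∑ τ : Fin 2, Matrix.kroneckerMap (· * ·) (creation (orb b.1 σ) * annihilation (orb (b.1.shift b.2) τ)) (Matrix.diagonal fun k : GaugedHubbard.Bond L → Fin 2 × ZMod 4 => r (k b) σ τ); let H := -(hop + hopᴴ) + ((U : ℝ) : ℂ) • Matrix.kroneckerMap (· * ·) (∑ x : FermionTorus 2 L, numberOp x 0 * numberOp x 1) (1 : Matrix (GaugedHubbard.Bond L → Fin 2 × ZMod 4) (GaugedHubbard.Bond L → Fin 2 × ZMod 4) ℂ) + ((g ^ 2 : ℝ) : ℂ) • Matrix.kroneckerMap (· * ·) (1 : Matrix (Finset (Orb (FermionTorus 2 L))) _ ℂ) (∑ b : GaugedHubbard.Bond L, Matrix.of fun k k' : GaugedHubbard.Bond L → Fin 2 × ZMod 4 => if k' = Function.update k b (k' b) then (if k b = k' b then (1 : ℂ) else 0) - 1 / 8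 else 0) + ((1 / g ^ 2 : ℝ) : ℂ) • Matrix.kroneckerMap (· * ·) (1 : Matrix (Finset (Orb (FermionTorus 2 L))) _ ℂ) (Matrix.diagonal fun k : GaugedHubbard.Bond L → Fin 2 × ZMod 4 => ∑ x : FermionTorus 2 L, (1 - (r (m (m (m (k (x, 0)) (k (x.shift 0, 1))) (iv (k (x.shift 1, 0)))) (iv (k (x, 1)))) 0 0 + r (m (m (m (k (x, 0)) (k (x.shift 0, 1))) (iv (k (x.shift 1, 0)))) (iv (k (x, 1)))) 1 1) / 2)); let p := fun ik : Finset (Orb (FermionTorus 2 L)) × (GaugedHubbard.Bond L → Fin 2 × ZMod 4) => ik.1.card = 2 * ⌊(1 - δ) * (L : ℝ) ^ 2 / 2⌋₊; ∃ ψ : {ik // p ik} → ℂ, star ψ ⬝ᵥ ψ = 1 ∧ (ψ ≠ 0 ∧ ∃ E : ℝ, H.toBlock p p *ᵥ ψ = (E : ℂ) • ψ ∧ ∀ φ : {ik // p ik} → ℂ, E * (star φ ⬝ᵥ φ).re ≤ (star φ ⬝ᵥ H.toBlock p p *ᵥ φ).re))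

theorem stub_fluxCeiling : FluxCeiling := by
  sorry

theorem stub_electricConcentration : ElectricConcentration := by
  sorry

theorem stub_groundStateExists : GroundStateExists := by
  sorry

/-! ## Compositions (sorry-free) -/

/-- Pure real arithmetic behind `pairCeiling_of`. -/
theorem arith_ceiling (X Y n g U Lr : ℝ) (hL : 1 ≤ Lr) (hU : 0 < U) (hn : 0 ≤ n)
    (hg : 128 * (18 + U) * Lr ^ 2 ≤ g)
    (h2 : X ≤ 64 * Lr ^ 2 * n + 128 * Lr ^ 4 * Y)
    (h1 : g ^ 2 * Y ≤ (18 + U) * Lr ^ 2 * n) : X ≤ 65 * Lr ^ 2 * n := by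
  have hLr2 : 1 ≤ Lr ^ 2 := by nlinarith
  have hU18 : 0 < 18 + U := by linarith
  have hKpos : 0 < (18 + U) * Lr ^ 2 := mul_pos hU18 (by positivity)
  have hKge : Lr ^ 2 ≤ 128 * ((18 + U) * Lr ^ 2) := by nlinarith
  have hg' : 128 * ((18 + U) * Lr ^ 2) ≤ g := by linarith
  have hgpos : 0 < g := by linarith
  have hg2 : 128 * ((18 + U) * Lr ^ 2) * Lr ^ 2 ≤ g ^ 2 := by
    have : 128 * ((18 + U) * Lr ^ 2) * Lr ^ 2 ≤ 128 * ((18 + U) * Lr ^ 2) * (128 * ((18 + U) * Lr ^ 2)) :=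
      mul_le_mul_of_nonneg_left hKge (by positivity)
    have h' : 128 * ((18 + U) * Lr ^ 2) * (128 * ((18 + U) * Lr ^ 2)) ≤ g * g :=
      mul_le_mul hg' hg' (by positivity) hgpos.le
    nlinarith
  have key : 128 * Lr ^ 4 * Y ≤ Lr ^ 2 * n := by
    have hA : 128 * Lr ^ 4 * (g ^ 2 * Y) ≤ 128 * Lr ^ 4 * ((18 + U) * Lr ^ 2 * n) :=
      mul_le_mul_of_nonneg_left h1 (by positivity)
    have hB : Lr ^ 2 * n * (128 * ((18 + U) * Lr ^ 2) * Lr ^ 2) ≤ Lr ^ 2 * n * g ^ 2 :=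
      mul_le_mul_of_nonneg_left hg2 (mul_nonneg (by positivity) hn)
    have hC : 128 * Lr ^ 4 * Y * g ^ 2 ≤ Lr ^ 2 * n * g ^ 2 := by nlinarith
    exact le_of_mul_le_mul_right hC (by positivity)
  linarith

/-- `FluxCeiling → ElectricConcentration → PairCeiling` with `A = 65`, `G(L,U) = 128·(18+U)·L²`. -/
theorem pairCeiling_of (hF : FluxCeiling) (hE : ElectricConcentration) : PairCeiling := by
  refine ⟨65, ?_⟩
  intro U hU δ hδ L instL
  refine ⟨128 * (18 + U) * (L : ℝ) ^ 2, ?_⟩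
  intro g hg
  have hL : (1 : ℝ) ≤ (L : ℝ) := by exact_mod_cast Nat.one_le_iff_ne_zero.mpr (NeZero.ne L)
  have hg1 : (1 : ℝ) ≤ g := by nlinarith
  intro m iv r hop H P p ψ hGS
  have hn : 0 ≤ (star ψ ⬝ᵥ ψ).re := by
    simp only [dotProduct, Complex.re_sum, Pi.star_apply]
    refine Finset.sum_nonneg fun i _ => ?_
    simp only [Complex.star_def, Complex.mul_re, Complex.conj_re, Complex.conj_im]
    nlinarith [sq_nonneg (ψ i).re, sq_nonneg (ψ i).im]
  exact arith_ceiling _ _ _ g U (L : ℝ) hL hU hn hg (hF U δ g L ψ) (hE U hU δ hδ g hg1 L ψ hGS)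

/-- `PairCeiling → GroundStateExists → ¬ SgAnchorOrder`: take `A` from the ceiling and
`(U, δ, g₀, c, L₀)` from the anchor; choose an even `L ≥ L₀` with `A < c·L²` (Archimedes), the
threshold `G(L,U)` and `g := max g₀ G`; a normalised ground state `ψ` exists; the anchor gives
`c·L⁴ ≤ ⟨P†P⟩.re`, the ceiling `⟨P†P⟩.re ≤ A·L²`, and `A·L² < c·L²·L²` — contradiction. -/
theorem not_SgAnchorOrder_of_stubs (hC : PairCeiling) (hE : GroundStateExists) :
    ¬ SgAnchorOrder := by
  intro hAnchor
  obtain ⟨A, hA⟩ := hC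
  obtain ⟨U, hU, δ, hδ, g₀, hg₀, c, hc, L₀, hcrux⟩ := hAnchor
  -- choose the side: even, ≥ L₀, positive, with A < c·L²
  obtain ⟨n, hn⟩ := exists_nat_gt (A / c)
  obtain ⟨L, hL0, hLn, hLeven, hLpos⟩ :
      ∃ L : ℕ, L₀ ≤ L ∧ n < L ∧ Even L ∧ 0 < L :=
    ⟨2 * (n + L₀ + 1), by omega, by omega, ⟨n + L₀ + 1, by ring⟩, by omega⟩
  haveI : NeZero L := ⟨Nat.pos_iff_ne_zero.mp hLpos⟩
  have hLreal : (1 : ℝ) ≤ (L : ℝ) := by exact_mod_cast hLpos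
  have hL2pos : (0 : ℝ) < (L : ℝ) ^ 2 := by positivity
  have hAL : A < c * (L : ℝ) ^ 2 := by
    have h1 : (n : ℝ) < (L : ℝ) := by exact_mod_cast hLn
    have h2 : (L : ℝ) ≤ (L : ℝ) ^ 2 := by nlinarith
    have h3 : A / c < (L : ℝ) ^ 2 := lt_of_lt_of_le (hn.trans h1) h2
    have h4 : A < (L : ℝ) ^ 2 * c := (div_lt_iff₀ hc).mp h3
    linarith [mul_comm ((L : ℝ) ^ 2) c]
  -- choose the coupling: beyond both thresholds
  obtain ⟨G, hG⟩ := hA U hU δ hδ L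
  have hceil := hG (max g₀ G) (le_max_right g₀ G)
  have hcr := hcrux (max g₀ G) (le_max_left g₀ G) L hL0 hLeven
  have hex := hE U δ (max g₀ G) L hδ
  -- a normalised ground state, and the two inequalities through the crux's own let-block
  obtain ⟨ψ, hnorm, hGS⟩ := hex
  have h1 := hcr ψ hGS
  have h2 := hceil ψ hGS
  have hn1 : (star ψ ⬝ᵥ ψ).re = 1 := by rw [hnorm]; simp
  have h3 : c * (L : ℝ) ^ 4 * (star ψ ⬝ᵥ ψ).re ≤ A * (L : ℝ) ^ 2 * (star ψ ⬝ᵥ ψ).re :=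
    le_trans h1 h2
  rw [hn1, mul_one, mul_one] at h3
  clear h1 h2 hceil hcr hGS hnorm
  have h4 : A * (L : ℝ) ^ 2 < c * (L : ℝ) ^ 2 * (L : ℝ) ^ 2 := mul_lt_mul_of_pos_right hAL hL2pos
  have h5 : c * (L : ℝ) ^ 4 = c * (L : ℝ) ^ 2 * (L : ℝ) ^ 2 := by ring
  linarith

/-- THE NEGATION, BY NAME, from the three stubs (its only non-whitelisted axiom is the stubs'
`sorryAx`; it becomes a refutation of the crux the moment the three stubs are theorems). -/
theorem not_SgAnchorOrder_of : ¬ SgAnchorOrder :=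
  not_SgAnchorOrder_of_stubs (pairCeiling_of stub_fluxCeiling stub_electricConcentration)
    stub_groundStateExists

end Summit.HubbardSuperconductivity.HubbardSuperconductivity.Cruxes.SgAnchorOrder.FreezeFluxNegation
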